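import Literature.NumberTheory.Automorphic.ArchInnerFormChartOrbLocal      -- ★ FILE G2 (LH3-p03 (g3)): `chartOrbGLoc`, `chartHaarGLoc`, `chartOrbG_eq_of_isHaarMeasure`; brings ★ G1, ★ `chartOrbG`
import Literature.MeasureTheory.Group.InvariantQuotientPiFactor            -- ★ p850262 (LH3-p03 (g3)): `exists_haar_homeomorph_map_quotientMeasure_pi`, `integral_descConj_quotientMeasure_eq_prod_of_map_eq'`
import HarnessLib

/-!
# `chartOrbG = Π_w chartOrbGLoc` — the `G′` chart orbital functional on product test functions is the product of the local ones
# ((PROD-QUOT-G′) FILE G3 of the LH3 direct road — the `G′`-side twin of ★ `ArchEndoscopicChartOrbPlaces`: Borel–Jacquet 1979 §4.1, Rogawski 1990 §8.2–8.3, Folland 1995 §2.6,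
# Gelbart 1975 (10.19))

Topic `NumberTheory/Automorphic`; namespace `Literature.NumberTheory.Automorphic.UnitaryGroup`.  THEOREMS ONLY (no `def`, no instance, no notation, no axiom, no `sorry`).  Cell
`pub/hodgecm-mathlib`, crux H413 (`stmt-HodgeConjecture-24833`), F0∕P3c line LH3 (closer stub `stub_N9`, DIRECT ROAD), organ «(PROD-QUOT-G′)» (LH3-p03 (g3)); count-neutral.

THE SETTING.  `G′_∞ = U(diag α)(L⁺ ⊗ ℝ)` with its place decomposition `e = archPiEquivCM 3 L (diagonal α) : G′_∞ ≃ₜ* Π_w U(α)_w` (★); at the DIAGONAL frame with `hα : ∀ i, α i ≠ 0`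
and an ADMISSIBLE label `S′` (`∀ w ∈ S′, w ∈ splitChartPlaces L α`), the chart torus `T_{S′} = chartTorusG L α S′` IS the product of the local tori `T′_{S′,w} = chartTorusGLoc L α w S′`
(★ `mem_chartTorusG_iff_forall_mem_chartTorusGLoc`, FILE G1).  PRODUCT-MEASURE CONVENTION (as ★ (V7)): per-place Haar `ν′_w` on `U(α)_w` and `ν′ = e⁻¹_* ⊗_w ν′_w`.
* §1 `chartBoxImgG_eq_setOf_forall_mem_chartBoxImgGLoc` — the box image `B′ ⊆ T_{S′}` is placewise the product of the local box images.
* §2 **`chartOrbG_eq_prod_chartOrbGLoc`** — THE HEAD: for a PRODUCT test function `a′ g = Π_w f_w ((e g)_w)` and EVERY coordinate `c` (no regularity, no integrability hypothesis),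
  `chartOrbG L α ν′ S′ a′ c = Π_w chartOrbGLoc L α w S′ ν′_w f_w (c w)` — ★ `chartOrbG_eq_of_isHaarMeasure` with the transported product torus measure of
  ★ `exists_haar_homeomorph_map_quotientMeasure_pi` ((mass) `= Π_w dt′_w(B′_{S′,w})`; product clause); the prefactors and integrals recombine place by place.  With ★ G2's
  `chartOrbGLoc_eq_integral_of_not_mem` the factor at a place `w ∉ S′` is the whole-`U(α)_w` orbital integral of `f_w` — the input of (J-G′)∕(G′-CAY)∕(J-DESC) on ONE
  product `a′`.
HONEST LABEL: HC_CM is proved only modulo the 7 printed citations (2 remaining: hLiu418 = `stmt-HodgeConjecture-24832`, h413 = `stmt-HodgeConjecture-24833`) until rung 0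
closes; measure-theoretic bookkeeping, moves no row of the books.

## References
* [BorelJacquet1979] A. Borel, H. Jacquet, *Automorphic forms and automorphic representations*, PSPM 33.1 (1979), §4.1 (`G_∞ = Π_v G(F_v)`, product measures).
* [Rogawski1990] J. D. Rogawski, *Automorphic Representations of Unitary Groups in Three Variables*, Ann. of Math. Stud. 123 (1990), §3.6 p. 31, §8.2 p. 122, §8.3 p. 124.
* [Folland1995] G. B. Folland, *A Course in Abstract Harmonic Analysis* (1995), §2.2, §2.6 Thm. 2.49, (2.52).
* [Gelbart1975] S. Gelbart, *Automorphic forms on adele groups*, Ann. of Math. Studies 83 (1975), §10, p. 155, (10.19).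
-/

set_option autoImplicit false

noncomputable section

open MeasureTheory MeasureTheory.Measure NumberField NumberField.InfinitePlace Matrix Complex Topology
open Literature.MeasureTheory.Group
open scoped MatrixGroups Matrix Classical ENNReal NNReal

namespace Literature.NumberTheory.Automorphic.UnitaryGroup

/-! ## §1 The box image is the product of the local box images -/

section Box

variable (L : Type) [Field L] [NumberField L] [IsCMField L] (α : Fin 3 → L) (S' : Finset {w : InfinitePlace L // IsComplex w})

/-- **The box image `B′ ⊆ T_{S′}` is placewise the product of the local box images** (frame hypotheses): `m ∈ B′ ↔ ∀ w, (e m)_w ∈ B′_{S′,w}` — all three slots of the local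
coordinate are read by the local chart, so the global box coordinate is just the family of the local ones. [cite: Rogawski1990, §8.2 p. 122] [cite: Folland1995, §2.2] -/
theorem chartBoxImgG_eq_setOf_forall_mem_chartBoxImgGLoc (hα : ∀ i, α i ≠ 0) (hS' : ∀ w, w ∈ S' → w ∈ splitChartPlaces L α) :
    chartBoxImgG L α S' = {m : ↥(chartTorusG L α S') | ∀ w : {w : InfinitePlace L // IsComplex w},
      (⟨archPiEquivCM 3 L (Matrix.diagonal α) m.1 w, (mem_chartTorusG_iff_forall_mem_chartTorusGLoc L α S' hα hS' _).1 m.2 w⟩ : ↥(chartTorusGLoc L α w S')) ∈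
        chartBoxImgGLoc L α w S'} := by
  ext m
  simp only [Set.mem_setOf_eq, mem_chartBoxImgGLoc_iff]
  constructor
  · rintro ⟨c, hc, rfl⟩ w
    refine ⟨c w, ?_, ?_⟩
    · rw [chartBox_eq_pi_chartBoxLoc] at hc
      exact hc w (Set.mem_univ w)
    · simp only [archPiEquivCM_gprimeTorus, gprimeBlock_eq_gprimeBlockAt]
  · intro h
    choose cw hcw hcweq using h
    refine ⟨fun w => cw w, ?_, ?_⟩
    · rw [chartBox_eq_pi_chartBoxLoc]
      exact fun w _ => hcw w
    · apply Subtype.ext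
      apply (archPiEquivCM 3 L (Matrix.diagonal α)).injective
      funext w
      rw [archPiEquivCM_gprimeTorus, gprimeBlock_eq_gprimeBlockAt]
      exact hcweq w

end Box

/-! ## §2 The head: `chartOrbG = Π_w chartOrbGLoc` on product test functions -/

section Head

variable (L : Type) [Field L] [NumberField L] [IsCMField L] (α : Fin 3 → L) (S' : Finset {w : InfinitePlace L // IsComplex w})
  [∀ w : {w : InfinitePlace L // IsComplex w}, MeasurableSpace ↥(archLocal L 3 (Matrix.diagonal α) w)]
  [∀ w : {w : InfinitePlace L // IsComplex w}, BorelSpace ↥(archLocal L 3 (Matrix.diagonal α) w)]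
  [MeasurableSpace ↥(arch (↥(maximalRealSubfield L)) L (IsCMField.complexConj L) 3 (Matrix.diagonal α))]
  [BorelSpace ↥(arch (↥(maximalRealSubfield L)) L (IsCMField.complexConj L) 3 (Matrix.diagonal α))]
  (ν'w : ∀ w : {w : InfinitePlace L // IsComplex w}, Measure ↥(archLocal L 3 (Matrix.diagonal α) w)) [∀ w, (ν'w w).IsHaarMeasure] [∀ w, (ν'w w).IsMulRightInvariant]
  (ν' : Measure ↥(arch (↥(maximalRealSubfield L)) L (IsCMField.complexConj L) 3 (Matrix.diagonal α))) [ν'.IsHaarMeasure] [ν'.IsMulRightInvariant]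
  (hν : ν' = (Measure.pi ν'w).map (archPiEquivCM 3 L (Matrix.diagonal α)).symm)

include hν in
/-- **THE `G′` CHART ORBITAL FUNCTIONAL ON PRODUCT TEST FUNCTIONS IS THE PRODUCT OF THE LOCAL ONES** (diagonal frame, `hα`, admissible `S′`; product-measure convention
`ν′ = e⁻¹_* ⊗_w ν′_w`): for every product test function `a′ g = Π_w f_w ((e g)_w)` on `G′_∞` and EVERY coordinate `c` (no regularity, no integrability hypothesis),
`chartOrbG L α ν′ S′ a′ c = Π_w chartOrbGLoc L α w S′ ν′_w f_w (c w)`. [cite: BorelJacquet1979, §4.1] [cite: Rogawski1990, §8.2 p. 122; §8.3 p. 124] [cite: Folland1995, §2.6 Thm. 2.49, (2.52)]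
[cite: Gelbart1975, p. 155 (10.19)] -/
theorem chartOrbG_eq_prod_chartOrbGLoc (hα : ∀ i, α i ≠ 0) (hS' : ∀ w, w ∈ S' → w ∈ splitChartPlaces L α)
    (a' : ↥(arch (↥(maximalRealSubfield L)) L (IsCMField.complexConj L) 3 (Matrix.diagonal α)) → ℂ)
    (f : ∀ w : {w : InfinitePlace L // IsComplex w}, ↥(archLocal L 3 (Matrix.diagonal α) w) → ℂ)
    (ha' : ∀ g, a' g = ∏ w, f w (archPiEquivCM 3 L (Matrix.diagonal α) g w))
    (c : {w : InfinitePlace L // IsComplex w} → Fin 3 → ℝ) :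
    chartOrbG L α ν' S' a' c = ∏ w, chartOrbGLoc L α w S' (ν'w w) (f w) (c w) := by
  haveI : ∀ w : {w : InfinitePlace L // IsComplex w}, LocallyCompactSpace ↥(archLocal L 3 (Matrix.diagonal α) w) := fun w => locallyCompactSpace_archLocal_three L α w
  haveI : ∀ w : {w : InfinitePlace L // IsComplex w}, SecondCountableTopology ↥(archLocal L 3 (Matrix.diagonal α) w) := fun w => secondCountableTopology_archLocal_three L α w
  letI : ∀ w : {w : InfinitePlace L // IsComplex w}, MeasurableSpace (↥(archLocal L 3 (Matrix.diagonal α) w) ⧸ chartTorusGLoc L α w S') := fun w => borel _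
  haveI : ∀ w : {w : InfinitePlace L // IsComplex w}, BorelSpace (↥(archLocal L 3 (Matrix.diagonal α) w) ⧸ chartTorusGLoc L α w S') := fun w => ⟨rfl⟩
  letI : MeasurableSpace (↥(arch (↥(maximalRealSubfield L)) L (IsCMField.complexConj L) 3 (Matrix.diagonal α)) ⧸ chartTorusG L α S') := borel _
  haveI : BorelSpace (↥(arch (↥(maximalRealSubfield L)) L (IsCMField.complexConj L) 3 (Matrix.diagonal α)) ⧸ chartTorusG L α S') := ⟨rfl⟩
  haveI : ∀ w, (chartHaarGLoc L α w S').IsHaarMeasure := fun w => isHaarMeasure_chartHaarGLoc L α w S'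
  haveI : ∀ w, (chartHaarGLoc L α w S').IsInvInvariant := fun w => isInvInvariant_chartHaarGLoc L α w S'
  haveI : ∀ w, SigmaFinite (chartHaarGLoc L α w S') := fun w => sigmaFinite_chartHaarGLoc L α w S'
  haveI := locallyCompactSpace_chartTorusG L α S'
  obtain ⟨ρ, hρH, hρI, Ψ, hmass, -, hΨsymm, hmap⟩ := exists_haar_homeomorph_map_quotientMeasure_pi
    (archPiEquivCM 3 L (Matrix.diagonal α)) (fun w => chartTorusGLoc L α w S') (fun w => isClosed_chartTorusGLoc L α w S') (chartTorusG L α S')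
    (isClosed_chartTorusG L α S') (mem_chartTorusG_iff_forall_mem_chartTorusGLoc L α S' hα hS') (fun w => chartHaarGLoc L α w S') ν'w ν' hν
  -- the box prefactor
  have hbox : ρ (chartBoxImgG L α S') = ∏ w, chartHaarGLoc L α w S' (chartBoxImgGLoc L α w S') := by
    rw [chartBoxImgG_eq_setOf_forall_mem_chartBoxImgGLoc L α S' hα hS']
    exact hmass fun w => chartBoxImgGLoc L α w S'
  -- the quotient integral
  have hint : ∫ y, descConj (gprimeTorus L α S' c) (chartTorusG L α S') (forall_mem_chartTorusG_comm L α S' c) a' y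
      ∂(quotientMeasure (chartTorusG L α S') ρ (isClosed_chartTorusG L α S') ν') =
      ∏ w, ∫ x, descConj (gprimeBlockAt L α w S' (c w)) (chartTorusGLoc L α w S') (forall_mem_chartTorusGLoc_comm L α w S' (c w)) (f w) x
        ∂(quotientMeasure (chartTorusGLoc L α w S') (chartHaarGLoc L α w S') (isClosed_chartTorusGLoc L α w S') (ν'w w)) :=
    integral_descConj_quotientMeasure_eq_prod_of_map_eq' (archPiEquivCM 3 L (Matrix.diagonal α)) (fun w => chartTorusGLoc L α w S') (fun w => isClosed_chartTorusGLoc L α w S') (chartTorusG L α S')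
      (isClosed_chartTorusG L α S') (fun w => chartHaarGLoc L α w S') ν'w ν' ρ Ψ hmap hΨsymm (fun w => gprimeBlockAt L α w S' (c w))
      (fun w => forall_mem_chartTorusGLoc_comm L α w S' (c w)) (forall_mem_chartTorusG_comm L α S' c) a' f ha'
  have hloc : ∀ w, chartOrbGLoc L α w S' (ν'w w) (f w) (c w) = ((chartHaarGLoc L α w S' (chartBoxImgGLoc L α w S')).toReal : ℂ) *
      ∫ x, descConj (gprimeBlockAt L α w S' (c w)) (chartTorusGLoc L α w S') (forall_mem_chartTorusGLoc_comm L α w S' (c w)) (f w) x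
        ∂(quotientMeasure (chartTorusGLoc L α w S') (chartHaarGLoc L α w S') (isClosed_chartTorusGLoc L α w S') (ν'w w)) := fun w => rfl
  rw [chartOrbG_eq_of_isHaarMeasure L α S' ν' ρ a' c]
  show ((ρ (chartBoxImgG L α S')).toReal : ℂ) * ∫ y, descConj (gprimeTorus L α S' c) (chartTorusG L α S') (forall_mem_chartTorusG_comm L α S' c) a' y
      ∂(quotientMeasure (chartTorusG L α S') ρ (isClosed_chartTorusG L α S') ν') = _
  rw [hint, hbox, ENNReal.toReal_prod, Complex.ofReal_prod]
  simp_rw [hloc]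
  rw [Finset.prod_mul_distrib]

end Head

end Literature.NumberTheory.Automorphic.UnitaryGroup

end
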